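import Literature.Geometry.Riemannian.ExponentialMapProofs
import Literature.Geometry.Riemannian.CompactComplete
import Literature.Geometry.Riemannian.MinimalSegments
import HarnessLib

/-!
# Hopf–Rinow on compact manifolds: geodesic completeness, and the reduction of the existence of
minimizing geodesics to the local theory of the exponential map (Lee 2018, Lemma 6.18 (a))

Sibling proof file of `Literature/Geometry/Riemannian/ExponentialMap.lean`, working towards the
named fact `hopfRinow_compact` stated there (Lee, *Introduction to Riemannian Manifolds*, 2nd ed.
(2018), Cor. 6.21 and Cor. 6.22: on a compact connected Riemannian manifold every maximal
geodesic is defined for all time, and any two points are joined by a minimizing geodesic segment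
`γ_v|[0,1]`). Everything here is PROVED; no definitions and no named facts are introduced
(D-0026). Builds on `ExponentialMapProofs.lean` (rescaling lemma, lengths of geodesic segments).

* Part (i) of the fact, **geodesic completeness of a compact Riemannian manifold**, is the tree's
  `PseudoRiemannianMetric.isGeodesicallyComplete_of_compactSpace` (`CompactComplete.lean`,
  O'Neill 1983, Ch. 5, Cor. 23); `hopfRinow_compact_geodesicallyComplete` puts it in the exact
  shape of the fact (smooth metric, `∞ ≤ n`).
* Plumbing for `γ_v` on a complete connection: the translation lemma
  `γ_{γ_v'(A)}(s) = γ_v(s + A)` (`maximalGeodesic_velocity_apply`), constant speed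
  `g(γ_v', γ_v') = g(v, v)` (`val_velocity_maximalGeodesic`), and `d(γ_v(a), γ_v(b)) ≤ b - a`
  for unit `v` (`edist_maximalGeodesic_le`).
* **The reduction** `exists_isMinimizingUpTo_of_local`: Lee's proof of Lemma 6.18 (a)
  (pp. 167–168: aim a unit-speed geodesic `γ` from `p` at `q` through a nearest point of a small
  sphere, let `A = sup {b : γ|[0,b] aims at q}` and show `A = d(p,q)` by aiming again from
  `γ(A)`), written so that the only inputs from the local theory of `exp` are two pointwise
  statements, taken as HYPOTHESES here (to be proved in sequel files; they are Lee's Prop. 6.11 /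
  Cor. 6.12–6.13 and the "no corners" remark of p. 168):
  (L1) every point `y` has a radius `δ > 0` below which each `x` is `exp_y v` for some `v` with
  `|v|_g = d(y, x)`, and
  (L2) "corner cutting": for unit vectors `u ≠ w` at `y`, `d(exp_y(-s u), exp_y(s w)) < 2 s` for
  all small `s > 0` (it follows from `d(exp_y)_0 = id`, Prop. 5.19 (d)).
  The aiming points themselves come for free from the metric Hopf–Rinow theorem already in the
  tree (`exists_isometric_segment`, `MinimalSegments.lean`): the point at parameter
  `δ / d(y, q)` of a metric segment from `y` to `q`.

## References

* J. M. Lee, *Introduction to Riemannian Manifolds*, 2nd ed., GTM 176 (2018): Lemma 5.18,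
  Prop. 5.19, Cor. 5.6, Prop. 6.11, Cor. 6.12–6.13, Lemma 6.18, Thm. 6.19, Cor. 6.21–6.22
  (pp. 127–131, 161–169). [LeeRiemannianManifolds2018]
* B. O'Neill, *Semi-Riemannian geometry*, Academic Press 1983, Ch. 5, Prop. 22, Cor. 23.
  [ONeill1983]
-/

noncomputable section

open Bundle Set Filter Manifold
open scoped Manifold ContDiff Topology ENNReal

namespace Literature.Geometry.Riemannian

open Literature.Geometry.Lorentzian
open Literature.Geometry.Lorentzian.PseudoRiemannianMetric

section Connection

variable {E : Type*} [NormedAddCommGroup E] [NormedSpace ℝ E] {H : Type*} [TopologicalSpace H]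
  {I : ModelWithCorners ℝ E H} {M : Type*} [TopologicalSpace M] [ChartedSpace H M]
  [IsManifold I ∞ M] [FiniteDimensional ℝ E]
  {cov : CovariantDerivative I E (TangentSpace I : M → Type _)}

/-- A geodesic defined on all of `ℝ` is continuous. [folklore] -/
theorem _root_.Literature.Geometry.Lorentzian.IsGeodesic.continuous {γ : ℝ → M}
    (h : IsGeodesic cov γ) : Continuous γ :=
  continuous_iff_continuousAt.2 fun t =>
    (IsGeodesicOn.mdifferentiableAt_holds (IsGeodesic.isGeodesicOn h univ) (mem_univ t)).continuousAt

variable [CompleteSpace E] [T2Space M] [BoundarylessManifold I M]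
  [CovariantDerivative.ContMDiffCovariantDerivative cov 1]

/-- **Translation lemma**: for a geodesic `γ` on `ℝ`, the maximal geodesic with initial data
`(γ A, γ'(A))` is `s ↦ γ (s + A)` (uniqueness of geodesics with the translated geodesic
`t ↦ γ (t + A)`, `IsGeodesicOn.comp_sub_const`; Lee, proof of Thm. 6.19, "by uniqueness of
geodesics the two definitions agree where they overlap"; cf. the flow property
`maximalGeodesic_tangentLift_apply` of `GeodesicContinuousDependence.lean`).
[cite: LeeRiemannianManifolds2018, Thm. 6.19 (proof)] -/
theorem maximalGeodesic_velocity_apply_of_isGeodesic {γ : ℝ → M} (hγ : IsGeodesic cov γ)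
    (A s : ℝ) : maximalGeodesic cov (γ A) (velocity I γ A) s = γ (s + A) := by
  have h1 : IsGeodesic cov (fun t => γ (t - -A)) := by
    have h := IsGeodesicOn.comp_sub_const (IsGeodesic.isGeodesicOn hγ univ) (-A)
    rwa [preimage_univ] at h
  have h2 : velocity I (fun t => γ (t - -A)) 0 = velocity I γ (0 - -A) :=
    velocity_comp_sub_const γ (-A) 0
  obtain ⟨-, heq⟩ :=
    maximalGeodesic_unique (IsGeodesic.isMaximalGeodesicOn_univ (cov := cov) h1) (mem_univ 0) rfl h2
  have key : maximalGeodesic cov (γ (0 - -A)) (velocity I γ (0 - -A)) = fun t => γ (t - -A) :=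
    (funext fun t => heq (mem_univ t)).symm
  have e0 : (0 : ℝ) - -A = A := by ring
  rw [e0] at key
  rw [key]
  dsimp only
  rw [sub_neg_eq_add]

/-- **Translation lemma for `γ_v` on a complete connection**: `γ_{γ_v'(A)}(s) = γ_v(s + A)`.
[cite: LeeRiemannianManifolds2018, Thm. 6.19 (proof)] -/
theorem maximalGeodesic_velocity_apply (hc : IsGeodesicallyComplete cov) (x : M)
    (v : TangentSpace I x) (A s : ℝ) :
    maximalGeodesic cov (maximalGeodesic cov x v A) (velocity I (maximalGeodesic cov x v) A) s =
      maximalGeodesic cov x v (s + A) :=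
  maximalGeodesic_velocity_apply_of_isGeodesic (maximalGeodesic_of_isGeodesicallyComplete hc x v).2.1
    A s

end Connection

/-! ### Length and speed of geodesics of a Riemannian metric -/

section Metric

variable {E : Type*} [NormedAddCommGroup E] [NormedSpace ℝ E] {H : Type*} [TopologicalSpace H]
  {I : ModelWithCorners ℝ E H} {M : Type*} [TopologicalSpace M] [ChartedSpace H M]
  [IsManifold I ∞ M] {n : ℕ∞ω} [FiniteDimensional ℝ E] [CompleteSpace E]
  {g : PseudoRiemannianMetric I n E (TangentSpace I : M → Type _)}

variable [T2Space M] [BoundarylessManifold I M] [Fact (1 ≤ n)] [g.HasLeviCivita]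
  [CovariantDerivative.ContMDiffCovariantDerivative g.leviCivita 1]

/-- **`γ_v` has constant speed `g(v, v)`** on a complete Riemannian manifold (O'Neill 1983, Ch. 3,
p. 69; Lee 2018, Cor. 5.6; the tree's `val_velocity_eq_of_isGeodesicOn_holds`).
[cite: LeeRiemannianManifolds2018, Cor. 5.6] -/
theorem val_velocity_maximalGeodesic (hc : IsGeodesicallyComplete g.leviCivita) (x : M)
    (v : TangentSpace I x) (t : ℝ) :
    g.val (maximalGeodesic g.leviCivita x v t) (velocity I (maximalGeodesic g.leviCivita x v) t)
      (velocity I (maximalGeodesic g.leviCivita x v) t) = g.val x v v := by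
  obtain ⟨-, hγ, hx, hv⟩ := maximalGeodesic_of_isGeodesicallyComplete hc x v
  have h := g.val_velocity_eq_of_isGeodesicOn_holds isOpen_univ Set.ordConnected_univ hγ
    (mem_univ t) (mem_univ 0)
  rw [h]
  have key : ∀ (y : M) (hy : maximalGeodesic g.leviCivita x v 0 = y) (w : TangentSpace I y)
      (hw : velocity I (maximalGeodesic g.leviCivita x v) 0 = w),
      g.val (maximalGeodesic g.leviCivita x v 0) (velocity I (maximalGeodesic g.leviCivita x v) 0)
        (velocity I (maximalGeodesic g.leviCivita x v) 0) = g.val y w w := by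
    intro y hy w hw
    subst hy
    subst hw
    rfl
  exact key x hx v hv

/-- **Distance along `γ_v` on a complete Riemannian manifold**: for a unit vector `v`,
`d(γ_v(a), γ_v(b)) ≤ L(γ_v|[a,b]) = b - a` (`a ≤ b`; `edist_maximalGeodesic_le_length` and
`length_maximalGeodesic`). [cite: LeeRiemannianManifolds2018, Cor. 5.6 and p. 36] -/
theorem edist_maximalGeodesic_le (hg : g.IsRiemannian) (hc : IsGeodesicallyComplete g.leviCivita)
    (x : M) {v : TangentSpace I x} (hv : g.val x v v = 1) {a b : ℝ} (hab : a ≤ b) :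
    g.edist hg (maximalGeodesic g.leviCivita x v a) (maximalGeodesic g.leviCivita x v b) ≤
      ENNReal.ofReal (b - a) := by
  have h := edist_maximalGeodesic_le_length hg hc x v hab
  rwa [length_maximalGeodesic hg hc x v a b, hv, Real.sqrt_one, mul_one] at h

/-- On a complete Riemannian manifold `exp_x(0) = γ_0(1) = x` and `γ_0` has length `0` on
`[0, 1]`, so `γ_0|[0,1]` is minimizing. [cite: LeeRiemannianManifolds2018, Prop. 5.19 (a)] -/
theorem isMinimizingUpTo_zero (hg : g.IsRiemannian) (hc : IsGeodesicallyComplete g.leviCivita)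
    (x : M) : IsMinimizingUpTo g hg x 0 1 := by
  have h1 : maximalGeodesic g.leviCivita x (0 : TangentSpace I x) 1 = x :=
    (expMap_eq_maximalGeodesic hc x (0 : TangentSpace I x)).symm.trans
      (expMap_zero (cov := g.leviCivita) x)
  refine ⟨?_, ?_⟩
  · rw [(maximalGeodesic_of_isGeodesicallyComplete hc x (0 : TangentSpace I x)).1]
    exact subset_univ _
  · rw [h1, edist_self hg, length_maximalGeodesic hg hc x (0 : TangentSpace I x) 0 1]
    simp

end Metric

/-! ### Hopf–Rinow on compact manifolds -/

section HopfRinow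

variable {E : Type*} [NormedAddCommGroup E] [NormedSpace ℝ E] {H : Type*} [TopologicalSpace H]
  {I : ModelWithCorners ℝ E H} {M : Type*} [TopologicalSpace M] [ChartedSpace H M]
  [IsManifold I ∞ M] {n : ℕ∞ω} [FiniteDimensional ℝ E] [CompleteSpace E]
  {g : PseudoRiemannianMetric I n E (TangentSpace I : M → Type _)}

/-- **Part (i) of `hopfRinow_compact`: a compact Riemannian manifold is geodesically complete**
(Lee 2018, Cor. 6.22: "If `M` is a compact Riemannian manifold, then every maximal geodesic in
`M` is defined for all time"; O'Neill 1983, Ch. 5, Cor. 23), in the shape of the fact: a smooth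
(`∞ ≤ n`) Riemannian metric on a compact Hausdorff manifold without boundary. This is the tree's
`isGeodesicallyComplete_of_compactSpace` (Gordon's criterion with the proper function `0`).
[cite: LeeRiemannianManifolds2018, Cor. 6.22] -/
theorem hopfRinow_compact_geodesicallyComplete [T2Space M] [CompactSpace M]
    [BoundarylessManifold I M] (hn : (∞ : ℕ∞ω) ≤ n) [g.HasLeviCivita] (hg : g.IsRiemannian) :
    IsGeodesicallyComplete g.leviCivita := by
  have h1 : (1 : ℕ∞ω) ≤ ((⊤ : ℕ∞) : ℕ∞ω) := by exact_mod_cast (le_top : (1 : ℕ∞) ≤ ⊤)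
  have h2 : (2 : ℕ∞ω) ≤ ((⊤ : ℕ∞) : ℕ∞ω) := by
    rw [show (2 : ℕ∞ω) = ((2 : ℕ∞) : ℕ∞ω) from rfl]
    exact WithTop.coe_le_coe.2 le_top
  haveI : Fact (1 ≤ n) := ⟨h1.trans hn⟩
  exact g.isGeodesicallyComplete_of_compactSpace (h2.trans hn) hg

/-- **Lee's Lemma 6.18 (a) on a compact manifold, reduced to the local theory of `exp`.**
Let `g` be a Riemannian metric on a compact connected Hausdorff manifold without boundary whose
Levi-Civita connection is `C¹` and geodesically complete. ASSUME the two pointwise statements of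
the local theory of the exponential map:
(L1) every `y` has a radius `δ > 0` such that every `x` with `d(y, x) < δ` is `exp_y v` for some
`v` with `|v|_g = d(y, x)` (Lee, Prop. 6.11 with Cor. 6.12–6.13: inside a geodesic ball the radial
geodesic to `x` is minimizing and `r(x) = d(y, x)`), and
(L2) for unit vectors `u ≠ w` at `y`, `d(exp_y(-s u), exp_y(s w)) < 2s` for all small `s > 0`
(a broken geodesic with a genuine corner is not minimizing; Lee p. 168 "it has no corners").
THEN any two points `p, q` are joined by a minimizing geodesic segment `γ_v|[0,1]`,
`exp_p v = q`. Proof (Lee, pp. 167–168): `T = d(p,q)`; a metric segment from `p` to `q`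
(`exists_isometric_segment`) gives `x` with `d(p,x) = δ`, `d(x,q) = T - δ`; by (L1)
`x = exp_p(δ u)`, `|u| = 1`; let `γ = γ_u` (defined on `ℝ`) and
`𝒜 = {b ∈ [0,T] : d(γ b, q) = T - b} ∋ δ`, closed, `A = max 𝒜`. If `A < T`, aim again from
`y = γ(A)`: `z = exp_y(δ' w)` with `d(z,q) = T - A - δ'`, so `d(p,z) ≥ A + δ'`; if `w ≠ γ'(A)`,
(L2) gives `s` with `d(γ(A-s), γ_w(s)) < 2s`, contradicting
`d(γ(A-s), γ_w(s)) ≥ d(p,z) - d(p,γ(A-s)) - d(γ_w(s),z) ≥ (A+δ') - (A-s) - (δ'-s)`; hence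
`w = γ'(A)`, `γ_w(s) = γ(A+s)`, `z = γ(A+δ')` and `A + δ' ∈ 𝒜`, a contradiction. So `A = T`,
`γ(T) = q`, and `v = T u` works (`L(γ_v|[0,1]) = T = d(p,q)`).
[cite: LeeRiemannianManifolds2018, Lemma 6.18 (a) (proof, pp. 167–168)] -/
theorem exists_isMinimizingUpTo_of_local [T2Space M] [CompactSpace M] [ConnectedSpace M]
    [BoundarylessManifold I M] [Fact (1 ≤ n)] [g.HasLeviCivita]
    [CovariantDerivative.ContMDiffCovariantDerivative g.leviCivita 1] (hg : g.IsRiemannian)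
    (hc : IsGeodesicallyComplete g.leviCivita)
    (hL1 : ∀ y : M, ∃ δ : ℝ, 0 < δ ∧ ∀ x : M, g.edist hg y x < ENNReal.ofReal δ →
      ∃ v : TangentSpace I y, riemannianExpMap g y v = x ∧
        ENNReal.ofReal (Real.sqrt (g.val y v v)) = g.edist hg y x)
    (hL2 : ∀ (y : M) (u w : TangentSpace I y), g.val y u u = 1 → g.val y w w = 1 → u ≠ w →
      ∃ s₀ : ℝ, 0 < s₀ ∧ ∀ s : ℝ, 0 < s → s < s₀ →
        g.edist hg (riemannianExpMap g y ((-s) • u)) (riemannianExpMap g y (s • w)) <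
          ENNReal.ofReal (2 * s))
    (p q : M) :
    ∃ v : TangentSpace I p, IsMinimizingUpTo g hg p v 1 ∧ riemannianExpMap g p v = q := by
  classical
  /- the distance as a finite real function -/
  have hfin : ∀ a b : M, g.edist hg a b ≠ ⊤ := fun a b => edist_ne_top hg a b
  set D : M → M → ℝ := fun a b => (g.edist hg a b).toReal with hDdef
  have hD : ∀ a b, g.edist hg a b = ENNReal.ofReal (D a b) := fun a b =>
    (ENNReal.ofReal_toReal (hfin a b)).symm
  have D_nonneg : ∀ a b, 0 ≤ D a b := fun a b => ENNReal.toReal_nonneg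
  have D_le : ∀ {a b : M} {r : ℝ}, g.edist hg a b ≤ ENNReal.ofReal r → 0 ≤ r → D a b ≤ r :=
    fun {a b r} h hr => by
      have h' := ENNReal.toReal_mono ENNReal.ofReal_ne_top h
      rwa [ENNReal.toReal_ofReal hr] at h'
  have D_triangle : ∀ a b c, D a c ≤ D a b + D b c := fun a b c => by
    have h := edist_triangle hg a b c
    rw [hD, hD, hD, ← ENNReal.ofReal_add (D_nonneg _ _) (D_nonneg _ _)] at h
    exact (ENNReal.ofReal_le_ofReal_iff (add_nonneg (D_nonneg _ _) (D_nonneg _ _))).1 h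
  have D_comm : ∀ a b, D a b = D b a := fun a b => by
    simp only [hDdef, edist_comm hg a b]
  have D_self : ∀ a, D a a = 0 := fun a => by simp [hDdef]
  have D_eq_zero : ∀ a b, D a b = 0 → a = b := fun a b h => by
    have h' : g.edist hg a b = 0 := by rw [hD, h, ENNReal.ofReal_zero]
    exact (edist_eq_zero_iff hg).1 h'
  have D_cont : ∀ a, Continuous fun z => D z a := fun a =>
    ENNReal.continuousOn_toReal.comp_continuous
      ((PseudoRiemannianMetric.continuous_edist hg).comp (continuous_id.prodMk continuous_const))
      fun z => hfin z a
  /- geodesics: `exp_y (c • w) = γ_w(c)`, unit speed geodesics do not increase distance -/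
  have hexp : ∀ (y : M) (w : TangentSpace I y) (c : ℝ),
      riemannianExpMap g y (c • w) = maximalGeodesic g.leviCivita y w c :=
    fun y w c => expMap_smul hc y w c
  have hdist : ∀ (y : M) (w : TangentSpace I y), g.val y w w = 1 → ∀ a b : ℝ, a ≤ b →
      D (maximalGeodesic g.leviCivita y w a) (maximalGeodesic g.leviCivita y w b) ≤ b - a :=
    fun y w hw a b hab => D_le (edist_maximalGeodesic_le hg hc y hw hab) (sub_nonneg.2 hab)
  /- aiming (Lee, (6.10)): from `y ≠ q`, a small `δ` and a unit `w` with
    `d(γ_w(δ), q) = d(y, q) - δ`; the radius is also below the (L1)-radius of `y`. -/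
  have aim : ∀ y : M, y ≠ q → ∃ δ : ℝ, 0 < δ ∧ δ < D y q ∧ ∃ w : TangentSpace I y,
      g.val y w w = 1 ∧ D (maximalGeodesic g.leviCivita y w δ) q = D y q - δ := by
    intro y hyq
    have hTpos : 0 < D y q :=
      lt_of_le_of_ne (D_nonneg y q) fun h => hyq (D_eq_zero y q h.symm)
    obtain ⟨δ₁, hδ₁, hball⟩ := hL1 y
    set δ : ℝ := min (δ₁ / 2) (D y q / 2) with hδ
    have hδpos : 0 < δ := lt_min (half_pos hδ₁) (half_pos hTpos)
    have hδ₁' : δ < δ₁ := (min_le_left _ _).trans_lt (half_lt_self hδ₁)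
    have hδT : δ < D y q := (min_le_right _ _).trans_lt (half_lt_self hTpos)
    -- the aiming point `z` on a metric segment from `y` to `q`
    obtain ⟨σ, hσ0, hσ1, hσ⟩ := exists_isometric_segment hg y q
    have hmem : δ / D y q ∈ Icc (0 : ℝ) 1 :=
      ⟨div_nonneg hδpos.le hTpos.le, (div_le_one hTpos).2 hδT.le⟩
    have htoReal : ∀ s t : ℝ, s ∈ Icc (0 : ℝ) 1 → t ∈ Icc (0 : ℝ) 1 →
        D (σ s) (σ t) = |s - t| * D y q := fun s t hs ht => by
      have h := congrArg ENNReal.toReal (hσ s hs t ht)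
      rwa [ENNReal.toReal_mul, ENNReal.toReal_ofReal (abs_nonneg _)] at h
    have hyz : D y (σ (δ / D y q)) = δ := by
      have h := htoReal 0 (δ / D y q) ⟨le_rfl, zero_le_one⟩ hmem
      rw [hσ0, zero_sub, abs_neg, abs_of_pos (div_pos hδpos hTpos),
        div_mul_cancel₀ _ hTpos.ne'] at h
      exact h
    have hzq : D (σ (δ / D y q)) q = D y q - δ := by
      have h := htoReal (δ / D y q) 1 hmem ⟨zero_le_one, le_rfl⟩
      rw [hσ1, abs_sub_comm, abs_of_nonneg (sub_nonneg.2 hmem.2), sub_mul, one_mul,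
        div_mul_cancel₀ _ hTpos.ne'] at h
      exact h
    -- (L1): `z = exp_y v`, `|v| = δ`
    obtain ⟨v, hvz, hvnorm⟩ := hball (σ (δ / D y q))
      (by rw [hD, hyz]; exact (ENNReal.ofReal_lt_ofReal_iff hδ₁).2 hδ₁')
    rw [hD, hyz] at hvnorm
    have hsqrt : Real.sqrt (g.val y v v) = δ :=
      (ENNReal.ofReal_eq_ofReal_iff (Real.sqrt_nonneg _) hδpos.le).1 hvnorm
    have hvv : g.val y v v = δ ^ 2 := by
      have h0 : 0 ≤ g.val y v v := by
        by_cases hv : v = 0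
        · rw [hv]; simp
        · exact (hg y v hv).le
      rw [← hsqrt, Real.sq_sqrt h0]
    refine ⟨δ, hδpos, hδT, δ⁻¹ • v, ?_, ?_⟩
    · simp only [map_smul, FunLike.coe_smul, Pi.smul_apply, smul_eq_mul, hvv]
      field_simp
    · have hsm : δ • (δ⁻¹ • v) = v := by
        rw [smul_smul, mul_inv_cancel₀ hδpos.ne', one_smul]
      rw [← hexp y (δ⁻¹ • v) δ, hsm, hvz, hzq]
  /- the case `p = q` -/
  by_cases hpq : p = q
  · subst hpq
    exact ⟨0, isMinimizingUpTo_zero hg hc p, riemannianExpMap_zero g p⟩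
  /- `p ≠ q`: aim from `p`, `γ = γ_u` -/
  obtain ⟨δ, hδpos, hδT, u, hu, haim⟩ := aim p hpq
  set T : ℝ := D p q with hT
  set γ : ℝ → M := maximalGeodesic g.leviCivita p u with hγdef
  obtain ⟨-, hγgeo', hγ0', -⟩ := maximalGeodesic_of_isGeodesicallyComplete hc p u
  have hγgeo : IsGeodesic g.leviCivita γ := hγgeo'
  have hγ0 : γ 0 = p := hγ0'
  have hγcont : Continuous γ := hγgeo.continuous
  have hDγ : ∀ a b : ℝ, a ≤ b → D (γ a) (γ b) ≤ b - a := hdist p u hu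
  have hDpγ : ∀ b : ℝ, 0 ≤ b → D p (γ b) ≤ b := fun b hb => by
    have h := hDγ 0 b hb
    rwa [hγ0, sub_zero] at h
  /- the set `𝒜` of parameters at which `γ` aims at `q`, and its maximum `A` -/
  set 𝒜 : Set ℝ := {b | b ∈ Icc 0 T ∧ D (γ b) q = T - b} with h𝒜
  have h𝒜closed : IsClosed 𝒜 :=
    isClosed_Icc.inter (isClosed_eq ((D_cont q).comp hγcont) (continuous_const.sub continuous_id))
  have hδmem : δ ∈ 𝒜 := ⟨⟨hδpos.le, hδT.le⟩, haim⟩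
  have h𝒜bdd : BddAbove 𝒜 := ⟨T, fun b hb => hb.1.2⟩
  have hAmem : sSup 𝒜 ∈ 𝒜 := h𝒜closed.csSup_mem ⟨δ, hδmem⟩ h𝒜bdd
  have hδA : δ ≤ sSup 𝒜 := le_csSup h𝒜bdd hδmem
  set A : ℝ := sSup 𝒜 with hAdef
  have hApos : 0 < A := hδpos.trans_le hδA
  have hAT : A ≤ T := hAmem.1.2
  have hAq : D (γ A) q = T - A := hAmem.2
  /- `A = T` -/
  have hAeqT : A = T := by
    by_contra hne
    have hAlt : A < T := lt_of_le_of_ne hAT hne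
    have hyq : γ A ≠ q := fun h => by
      rw [h, D_self] at hAq
      linarith
    -- aim again from `y = γ A`
    obtain ⟨δ', hδ'pos, hδ'lt, w, hw, haim'⟩ := aim (γ A) hyq
    rw [hAq] at hδ'lt haim'
    -- the incoming direction `γ'(A)` is a unit vector
    have hu' : g.val (γ A) (velocity I γ A) (velocity I γ A) = 1 := by
      rw [hγdef, val_velocity_maximalGeodesic hc p u A, hu]
    -- `d(p, z) ≥ A + δ'` for the new aiming point `z = γ_w(δ')`
    have hpz : A + δ' ≤ D p (maximalGeodesic g.leviCivita (γ A) w δ') := by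
      have h := D_triangle p (maximalGeodesic g.leviCivita (γ A) w δ') q
      linarith
    -- no corner: `w = γ'(A)`
    have hwu : w = velocity I γ A := by
      by_contra hne'
      obtain ⟨s₀, hs₀, hcut⟩ := hL2 (γ A) (velocity I γ A) w hu' hw (Ne.symm hne')
      set s : ℝ := min (s₀ / 2) (min δ' A) with hs
      have hspos : 0 < s := lt_min (half_pos hs₀) (lt_min hδ'pos hApos)
      have hss₀ : s < s₀ := (min_le_left _ _).trans_lt (half_lt_self hs₀)
      have hsδ' : s ≤ δ' := (min_le_right _ _).trans (min_le_left _ _)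
      have hsA : s ≤ A := (min_le_right _ _).trans (min_le_right _ _)
      -- (L2): the broken geodesic is cut short
      have key₁ : D (γ (A - s)) (maximalGeodesic g.leviCivita (γ A) w s) < 2 * s := by
        have h := hcut s hspos hss₀
        rw [hexp (γ A) (velocity I γ A) (-s), hexp (γ A) w s, hγdef,
          maximalGeodesic_velocity_apply hc p u A (-s), ← hγdef, hD] at h
        have h' := (ENNReal.ofReal_lt_ofReal_iff (by positivity)).1 h
        rwa [show -s + A = A - s by ring] at h'
      -- but the triangle inequality gives `≥ 2 s`
      have key₂ : 2 * s ≤ D (γ (A - s)) (maximalGeodesic g.leviCivita (γ A) w s) := by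
        have h1 : D p (γ (A - s)) ≤ A - s := hDpγ (A - s) (by linarith)
        have h2 : D (maximalGeodesic g.leviCivita (γ A) w s)
            (maximalGeodesic g.leviCivita (γ A) w δ') ≤ δ' - s := hdist (γ A) w hw s δ' hsδ'
        have h3 := D_triangle p (γ (A - s)) (maximalGeodesic g.leviCivita (γ A) w δ')
        have h4 := D_triangle (γ (A - s)) (maximalGeodesic g.leviCivita (γ A) w s)
          (maximalGeodesic g.leviCivita (γ A) w δ')
        linarith
      linarith
    -- hence the new geodesic continues `γ`, and `A + δ' ∈ 𝒜`
    have hcont' : ∀ s : ℝ, maximalGeodesic g.leviCivita (γ A) w s = γ (s + A) := fun s => by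
      rw [hwu, hγdef, maximalGeodesic_velocity_apply hc p u A s]
    have hmem' : A + δ' ∈ 𝒜 := by
      refine ⟨⟨by linarith, by linarith⟩, ?_⟩
      rw [add_comm A δ', ← hcont' δ', haim']
      ring
    have : A + δ' ≤ A := le_csSup h𝒜bdd hmem'
    linarith
  /- conclusion: `γ(T) = q`, `v = T u` -/
  have hγT : γ T = q := by
    rw [hAeqT, sub_self] at hAq
    exact D_eq_zero _ _ hAq
  have hTpos : 0 ≤ T := D_nonneg p q
  refine ⟨T • u, ⟨?_, ?_⟩, ?_⟩
  · rw [(maximalGeodesic_of_isGeodesicallyComplete hc p (T • u)).1]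
    exact subset_univ _
  · rw [length_maximalGeodesic hg hc p (T • u) 0 1, maximalGeodesic_smul hc p u T 1, mul_one,
      ← hγdef, hγT, hD p q]
    congr 1
    simp only [map_smul, FunLike.coe_smul, Pi.smul_apply, smul_eq_mul, hu, mul_one,
      sub_zero, one_mul]
    rw [← sq, Real.sqrt_sq hTpos]
  · rw [hexp p u T, ← hγdef, hγT]

end HopfRinow

end Literature.Geometry.Riemannian
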